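import Literature.Analysis.FluidPDE.RusinSverakSingularTimeProofs
import Literature.Analysis.FluidPDE.RusinSverakSingularPointProofs
import Literature.Analysis.FluidPDE.RusinSverakLerayWeakStrong
import Literature.Analysis.FluidPDE.RusinSverakKatoBoundHolds
import Literature.Analysis.FluidPDE.LerayFarFieldRegularity
import Literature.Analysis.FluidPDE.KatoLocalHolds
import HarnessLib

/-!
# Rusin–Šverák, Cor. 4.3, over the remaining local-Leray leaves

Analysis/FluidPDE proof file (no definitions, no named facts) for the named fact
`Literature.Analysis.FluidPDE.rusin_sverak_minimal_data_compact` (`RusinSverakCompactness.lean`;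
W. Rusin, V. Šverák, *Minimal initial data for potential Navier–Stokes singularities*,
J. Funct. Anal. 260 (2011) 879–891 = arXiv:0911.0500, **Cor. 4.3** p. 8, second clause: the set
`M` of `Ḣ^{1/2}`-minimal blow-up data is compact modulo scalings and translations; first clause
`rusin_sverak_minimal_blowup`, `RusinSverakMinimalData.lean`).

The accepted assembly `rusin_sverak_minimal_data_compact_of_continuation`
(`RusinSverakSingularTimeProofs.lean`) derives Cor. 4.3 from four inputs: Kato's local existence
theorem `kato_local`, the `L^∞` continuation of Kato solutions
`IsKatoSolutionOn.continuation_of_bounded`, the far-field bound of Kato solutions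
`IsKatoSolutionOn.farField_bound`, and Cor. 4.2 `rusin_sverak_weak_limit_of_singular_points`.
The first two are now theorems of the tree (`kato_local_holds`, `KatoLocalHolds.lean`;
`IsKatoSolutionOn.continuation_of_bounded_holds`, `RusinSverakSingularPointProofs.lean`), as is
Kato's weighted bound **R** (`kato_solution_le_div_sqrt_holds`, `RusinSverakKatoBoundHolds.lean`)
and the uniqueness theorem (`kato_unique_holds`). The last two are reduced in the tree to the
local Leray theory: `IsKatoSolutionOn.farField_bound_of_leray_theory : E → W → F → _`
(`LerayFarFieldRegularity.lean`) and
`rusin_sverak_weak_limit_of_singular_points_of_local_leray_theory : E → U → A → R → S → _`,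
`leray_solution_ae_eq_kato_of_local_leray_theory : U → A → W` (`RusinSverakLerayWeakStrong.lean`).

This file plugs the discharged theorems in and records Cor. 4.3 (both clauses) as a consequence
of exactly the named facts that are still undischarged:

* over **E**, **W**, **F**, **S** (`rusin_sverak_minimal_data_compact_of_leray_leaves`,
  `rusin_sverak_minimal_blowup_of_leray_leaves`), and
* over **E**, **U**, **A**, **F**, **S** (`rusin_sverak_minimal_data_compact_of_local_leray_leaves`,
  `rusin_sverak_minimal_blowup_of_local_leray_leaves`),

where **E** = `leray_solution_exists_of_memLp_three` (local Leray solutions exist for `L³`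
data), **W** = `leray_solution_ae_eq_kato` (Rusin–Šverák Thm. 4.1), **U** =
`local_leray_weak_strong_uniqueness` (Lemarié-Rieusset Thm. 14.7), **A** =
`kato_isLocalLeraySolutionOn` (Lemarié-Rieusset Thm. 15.1 (A)), **F** =
`leray_solution_farField_bound` (far-field regularity of local Leray solutions), **S** =
`rusin_sverak_leray_singular_points_stable` (Rusin–Šverák Thm. 4.2 with Lemma 2.1). The
discharge `rusin_sverak_minimal_data_compact_holds` is the application of either theorem to the
`_holds` theorems of its leaves, once they exist; it also merges, already now, the import
closures of the Kato-side discharges with the local-Leray side (no conflicts).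

## Mathlib / tree search

Tree only (Mathlib has no Navier–Stokes theory): the assemblies and discharges named above
(`lean search 'rusin_sverak_minimal_data_compact_of|_holds'`); alternative assemblies of the same
fact in the tree: `…_of_leray_theory'`, `…_of_local_leray_theory` (hypothesis `N′`),
`…_of_weak_stability`, `…_of_jia_sverak`, `…_of_pressure_decay` (deeper leaves of **S**),
`…_of_singular_points'` (`N`, `C`).

## References

* W. Rusin, V. Šverák, J. Funct. Anal. 260 (2011) 879–891 = arXiv:0911.0500, Thm. 4.1 (p. 6),
  Thm. 4.2 (p. 7), Cor. 4.2, Cor. 4.3 and their proofs (p. 8). [RusinSverak2011]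
* P. G. Lemarié-Rieusset, *The Navier–Stokes Problem in the 21st Century*, CRC Press 2016,
  doi:10.1201/b19556, Thm. 14.7, Thm. 15.1 (A)–(C) and proofs (PDF pp. 565–566).
  [LemarieRieusset2016]
* T. Kato, Math. Z. 187 (1984) 471–480, Thm. 1. [Kato1984]
-/

noncomputable section

namespace Literature.Analysis.FluidPDE

/-- **Rusin–Šverák, Cor. 4.3, second clause, over E, W, F, S.** The compactness modulo
symmetries of the set of minimal blow-up data (`rusin_sverak_minimal_data_compact`) follows from
the existence of local Leray solutions for `L³` data (**E**), Rusin–Šverák's Thm. 4.1 (**W**),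
the far-field regularity of local Leray solutions (**F**) and the stability of singular points
Thm. 4.2 + Lemma 2.1 (**S**): `rusin_sverak_minimal_data_compact_of_continuation` with
`kato_local_holds`, `IsKatoSolutionOn.continuation_of_bounded_holds`, the far-field bound from
`IsKatoSolutionOn.farField_bound_of_leray_theory`, and Cor. 4.2 from
`rusin_sverak_weak_limit_of_singular_points_of_leray_theory` with `kato_solution_le_div_sqrt_holds`.
[cite: RusinSverak2011, Cor. 4.3 and its proof (arXiv:0911.0500 p. 8)] -/
theorem rusin_sverak_minimal_data_compact_of_leray_leaves
    (hE : leray_solution_exists_of_memLp_three) (hW : leray_solution_ae_eq_kato)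
    (hF : leray_solution_farField_bound) (hS : rusin_sverak_leray_singular_points_stable) :
    rusin_sverak_minimal_data_compact :=
  rusin_sverak_minimal_data_compact_of_continuation kato_local_holds
    IsKatoSolutionOn.continuation_of_bounded_holds
    (IsKatoSolutionOn.farField_bound_of_leray_theory hE hW hF)
    (rusin_sverak_weak_limit_of_singular_points_of_leray_theory hE hW
      kato_solution_le_div_sqrt_holds hS)

/-- **Rusin–Šverák, Cor. 4.3, first clause, over E, W, F, S** (`rusin_sverak_minimal_blowup`:
minimal blow-up data exist when `ρ_max < ∞`): `rusin_sverak_minimal_blowup_of_continuation` with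
the same discharged inputs. [cite: RusinSverak2011, Cor. 4.3 and its proof (arXiv:0911.0500 p. 8)] -/
theorem rusin_sverak_minimal_blowup_of_leray_leaves
    (hE : leray_solution_exists_of_memLp_three) (hW : leray_solution_ae_eq_kato)
    (hF : leray_solution_farField_bound) (hS : rusin_sverak_leray_singular_points_stable) :
    rusin_sverak_minimal_blowup :=
  rusin_sverak_minimal_blowup_of_continuation kato_local_holds
    IsKatoSolutionOn.continuation_of_bounded_holds
    (IsKatoSolutionOn.farField_bound_of_leray_theory hE hW hF)
    (rusin_sverak_weak_limit_of_singular_points_of_leray_theory hE hW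
      kato_solution_le_div_sqrt_holds hS)

/-- **Rusin–Šverák, Cor. 4.3, second clause, over E, U, A, F, S**: as
`rusin_sverak_minimal_data_compact_of_leray_leaves`, with Thm. 4.1 (**W**) supplied by the
weak–strong uniqueness theorem for local Leray solutions (**U**, Lemarié-Rieusset Thm. 14.7) and
the local Leray property of Kato solutions (**A**, Thm. 15.1 (A)) through
`leray_solution_ae_eq_kato_of_local_leray_theory`.
[cite: RusinSverak2011, Cor. 4.3 and its proof (arXiv:0911.0500 p. 8)] -/
theorem rusin_sverak_minimal_data_compact_of_local_leray_leaves
    (hE : leray_solution_exists_of_memLp_three) (hU : local_leray_weak_strong_uniqueness)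
    (hA : kato_isLocalLeraySolutionOn) (hF : leray_solution_farField_bound)
    (hS : rusin_sverak_leray_singular_points_stable) : rusin_sverak_minimal_data_compact :=
  rusin_sverak_minimal_data_compact_of_leray_leaves hE
    (leray_solution_ae_eq_kato_of_local_leray_theory hU hA) hF hS

/-- **Rusin–Šverák, Cor. 4.3, first clause, over E, U, A, F, S**: as
`rusin_sverak_minimal_blowup_of_leray_leaves`, with **W** from **U** and **A**.
[cite: RusinSverak2011, Cor. 4.3 and its proof (arXiv:0911.0500 p. 8)] -/
theorem rusin_sverak_minimal_blowup_of_local_leray_leaves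
    (hE : leray_solution_exists_of_memLp_three) (hU : local_leray_weak_strong_uniqueness)
    (hA : kato_isLocalLeraySolutionOn) (hF : leray_solution_farField_bound)
    (hS : rusin_sverak_leray_singular_points_stable) : rusin_sverak_minimal_blowup :=
  rusin_sverak_minimal_blowup_of_leray_leaves hE
    (leray_solution_ae_eq_kato_of_local_leray_theory hU hA) hF hS

end Literature.Analysis.FluidPDE

end
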